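import Summits.ResolutionOfSingularities.ResolutionOfSingularities.Theorems.EquisingularLiftEquisingularLiftNatNosePackage
import Summits.ResolutionOfSingularities.ResolutionOfSingularities.Theorems.EquisingularLiftEquisingularLiftNatPointResolutionRel
import HarnessLib

/-!
# [OURS · L1 W4.5(b) · EL♮] (5) T-NOSE-THEN-POINTS, INTRINSIC DOWNSTAIRS FORM: «blow `H` up along `Λ · 𝒪_H`, then resolve the
# blown-up surface by point blow-ups» (res-L1-w45b-lead-2's TARGET (5) 2026-08-27T07:04:41Z, downstairs hypothesis on `H` itself)

Crux `EquisingularLiftNat` = stmt-ResolutionOfSingularities-20038 (route EquisingularLift), line `sections`; helper file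
`--supports … --as helper` by res-type-051 (TAKING 2026-08-27T07:23:26Z). HONEST FRAMING: OURS (cell res-hironaka, slot W4.5(b));
NOT a statement of any manuscript; a CONDITIONAL rung as its sibling …NatNoseThenPoints.lean. AI-written, weaker than expert review.
No `sorry`; standard axioms.

The sibling `elNatBody_of_noseThenPoints` (…NatNoseThenPoints.lean) states the downstairs hypothesis (b) on the EMBEDDED strict
transform `closure υ⁻¹(ι(H) ∖ V(Λ)) ⊆ Bl_Λ ℙⁿ_k`. Specimen authors compute with the surface itself; this file moves (b) to `H`:

* `elNatBody_of_noseThenPoints_intrinsic` — HYP (a) as in the sibling (`C ⊂ ℙⁿ_O` with `V(C) → Spec O` SMOOTH,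
  `ι(H) ⊄ V(Λ) ⊆ ι(H)`, `Λ = C · 𝒪_{ℙⁿ_k}`); HYP (b′): SOME blow-up `ρ : Z → H` of `H` along `Λ · 𝒪_H = Λ.comap ι` is
  point-resolvable INTRINSICALLY — the PtChain ∃-form of T-ISO-0 for the pair `(Z, univ)` (blow the running scheme up at a
  non-regular closed point, keep the closure of the complement of the blown-up point, end with a regular reduced scheme)
  ⇒ the `∃ (P′, σ, S′)` body of the item for `Y = g(ι(H))`. PROOF: `nosePackage₀` (p512238) gives the upstairs stage and
  `V(closure T₂)_red ≅ V(closure S₁)_red` for the embedded strict transform `T₂`; `V(closure T₂)_red` is a blow-up of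
  `V(ι(H))_red ≅ H` along the trace of `Λ` (DL `exists_isBlowup_reducedStrictTransform`, p167331), hence `≅ Z` (`IsBlowup.comp_iso`,
  `IsBlowup.unique`); `Z` is integral (`IsBlowup.isIntegral`), so `V(closure univ)_red ≅ Z`; then res-type-022's
  `pointResolution_from_horizStage` (p509452) from the nose stage with `F₀ := Z`, `T₀ := univ`, and p500485 for the item's clause.
* `elNatOver_of_noseThenPoints_intrinsic` / `elNatAt_of_noseThenPoints_intrinsic` — packaged as `ELNatOver` / `ELNatAt` (p503491)
  with `Λ` given on `ℙⁿ_k` and the `hKEY` device of `elNatOver_of_oneStep₀` (p505461).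

References: …NatNoseThenPoints.lean (sibling, embedded form), …NatNosePackage.lean (p512238), …NatPointResolutionRel.lean (p509452),
…ReducedStrictTransformBlowup.lean (p167331), Literature/…/BlowupsIntegral.lean; Liu 2002 §8.1; Stacks 080E.
-/

set_option linter.dupNamespace false -- mandated namespace `Summit.<Summit>.<Problem>` of this single-conjunct summit
set_option linter.overlappingInstances false -- signatures carry `[IsDomain O] [IsDiscreteValuationRing O]`

noncomputable section

open CategoryTheory CategoryTheory.Limits AlgebraicGeometry TopologicalSpace Topology
open MvPolynomial
open Literature.AlgebraicGeometry.Resolution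
open AlgebraicGeometry.Scheme.IdealSheafData
open Summit.ResolutionOfSingularities.ResolutionOfSingularities.Theses.EquisingularLift.Split
open Summit.ResolutionOfSingularities.ResolutionOfSingularities.Cruxes.EquisingularLift.StrataSplit

attribute [local instance] MvPolynomial.gradedAlgebra

namespace Summit.ResolutionOfSingularities.ResolutionOfSingularities.Cruxes.EquisingularLiftNat.Sections

/-- **(5) T-NOSE-THEN-POINTS with the downstairs hypothesis on `H` itself** (module docstring for the reading): `O` a complete DVR
with algebraically closed residue field, `π : O → k` surjective, `ι : H → ℙⁿ_k` a closed immersion of an integral scheme, `φ` graded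
over `π`, `Y = (ι ≫ Proj φ)(H)`; (a) `C ⊂ ℙⁿ_O` with `V(C) → Spec O` SMOOTH, `ι(H) ⊄ V(Λ)`, `V(Λ) ⊆ ι(H)` (`Λ = C · 𝒪_{ℙⁿ_k}`);
(b′) some blow-up `Z → H` along `Λ · 𝒪_H` is resolved by finitely many point blow-ups at non-regular closed points (PtChain
∃-form for `(Z, univ)`). THEN some `(P′, σ, S′)` in the item's E1-chain closure of `(ℙⁿ_O, 𝟙, Y)` has irreducible special fibre
and regular `V(closure S′)_red`. [folklore; Liu 2002 §8.1/§9.2; Stacks 080E] -/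
theorem elNatBody_of_noseThenPoints_intrinsic (O : Type) [CommRing O] [IsDomain O] [IsDiscreteValuationRing O]
    [IsAdicComplete (IsLocalRing.maximalIdeal O) O] [IsAlgClosed (IsLocalRing.ResidueField O)]
    (k : Type) [Field k] (π : O →+* k) (hπ : Function.Surjective π) (n : ℕ) (H : Scheme.{0})
    (ι : H ⟶ Proj (homogeneousSubmodule (Fin (n + 1)) k)) [IsClosedImmersion ι] [IsIntegral H]
    (φ : homogeneousSubmodule (Fin (n + 1)) O →+*ᵍ homogeneousSubmodule (Fin (n + 1)) k)
    (hφ' : HomogeneousIdeal.irrelevant (homogeneousSubmodule (Fin (n + 1)) k) ≤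
      (HomogeneousIdeal.irrelevant (homogeneousSubmodule (Fin (n + 1)) O)).map φ)
    (hφ : ∀ s, φ s = MvPolynomial.map π s)
    -- (a) THE NOSE
    (C : (Proj (homogeneousSubmodule (Fin (n + 1)) O)).IdealSheafData)
    (hCsm : Smooth (C.subschemeι ≫ Proj.toSpecZero (homogeneousSubmodule (Fin (n + 1)) O) ≫
      Spec.map (CommRingCat.ofHom (algebraMap O (homogeneousSubmodule (Fin (n + 1)) O 0)))))
    (hgen : ¬ (Set.range ι ⊆ ((C.comap (Proj.map φ hφ')).support : Set (Proj (homogeneousSubmodule (Fin (n + 1)) k)))))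
    (hsupp : ((C.comap (Proj.map φ hφ')).support : Set (Proj (homogeneousSubmodule (Fin (n + 1)) k))) ⊆ Set.range ι)
    -- (b′) THEN POINTS, intrinsically on a blow-up of `H` along `Λ · 𝒪_H`
    (hdown : ∃ (Z : Scheme.{0}) (ρ : Z ⟶ H), IsBlowup ρ ((C.comap (Proj.map φ hφ')).comap ι) ∧
      ∃ (F' : Scheme.{0}) (ρ' : F' ⟶ Z) (T' : Set F'),
        (∀ Q : (∀ F₁ : Scheme.{0}, (F₁ ⟶ Z) → Set F₁ → Prop), Q Z (𝟙 Z) Set.univ →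
          (∀ (F₁ F₃ : Scheme.{0}) (ρ₁ : F₁ ⟶ Z) (T₁ : Set F₁)
            (x : ↥(vanishingIdeal (⟨closure T₁, isClosed_closure⟩ : Closeds F₁)).subscheme) (υ₁ : F₃ ⟶ F₁)
            (hx : IsClosed ({((vanishingIdeal (⟨closure T₁, isClosed_closure⟩ : Closeds F₁)).subschemeι x : F₁)} : Set F₁)),
            Q F₁ ρ₁ T₁ →
            ¬ IsRegularLocalRing ((vanishingIdeal (⟨closure T₁, isClosed_closure⟩ : Closeds F₁)).subscheme.presheaf.stalk x) →
            IsBlowup υ₁ (vanishingIdeal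
              (⟨{((vanishingIdeal (⟨closure T₁, isClosed_closure⟩ : Closeds F₁)).subschemeι x : F₁)}, hx⟩ : Closeds F₁)) →
            Q F₃ (υ₁ ≫ ρ₁) (closure (υ₁ ⁻¹' (T₁ \
              {((vanishingIdeal (⟨closure T₁, isClosed_closure⟩ : Closeds F₁)).subschemeι x : F₁)})))) →
          Q F' ρ' T') ∧
        Scheme.IsRegular (vanishingIdeal (⟨closure T', isClosed_closure⟩ : Closeds F')).subscheme) :
    ∀ Y : Set (Proj (homogeneousSubmodule (Fin (n + 1)) O)), Y = Set.range (ι ≫ Proj.map φ hφ') →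
    ∃ (P' : Scheme.{0}) (σ : P' ⟶ Proj (homogeneousSubmodule (Fin (n + 1)) O)) (S' : Set P'),
      (∀ Q : (∀ X' : Scheme.{0}, (X' ⟶ Proj (homogeneousSubmodule (Fin (n + 1)) O)) → Set X' → Prop),
        Q (Proj (homogeneousSubmodule (Fin (n + 1)) O)) (𝟙 _) Y →
        (∀ (X' X'' : Scheme.{0}) (σ' : X' ⟶ Proj (homogeneousSubmodule (Fin (n + 1)) O)) (Y' : Set X')
          (C : X'.IdealSheafData) (τ : X'' ⟶ X'), Q X' σ' Y' → IsBlowup τ C → Scheme.IsRegular C.subscheme →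
          σ' '' (C.support : Set X') ⊆ {x | ¬ IsGenericPoint x Y} →
          (C.support : Set X') ∩ (σ' ≫ (Proj.toSpecZero (homogeneousSubmodule (Fin (n + 1)) O) ≫
            Spec.map (CommRingCat.ofHom (algebraMap O (homogeneousSubmodule (Fin (n + 1)) O 0))))) ⁻¹'
            {IsLocalRing.closedPoint O} ⊆ Y' →
          Q X'' (τ ≫ σ') (closure (τ ⁻¹' (Y' \ (C.support : Set X'))))) → Q P' σ S') ∧
      IsIrreducible ((σ ≫ (Proj.toSpecZero (homogeneousSubmodule (Fin (n + 1)) O) ≫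
        Spec.map (CommRingCat.ofHom (algebraMap O (homogeneousSubmodule (Fin (n + 1)) O 0))))) ⁻¹'
        {IsLocalRing.closedPoint O}) ∧
      Scheme.IsRegular (vanishingIdeal (⟨closure S', isClosed_closure⟩ : Closeds P')).subscheme := by
  classical
  set q : (Proj (homogeneousSubmodule (Fin (n + 1)) O)) ⟶ Spec (.of O) := Proj.toSpecZero (homogeneousSubmodule (Fin (n + 1)) O) ≫
    Spec.map (CommRingCat.ofHom (algebraMap O (homogeneousSubmodule (Fin (n + 1)) O 0))) with hqdef
  set g : Proj (homogeneousSubmodule (Fin (n + 1)) k) ⟶ (Proj (homogeneousSubmodule (Fin (n + 1)) O)) := Proj.map φ hφ' with hgdef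
  set Λ : (Proj (homogeneousSubmodule (Fin (n + 1)) k)).IdealSheafData := C.comap g with hΛdef
  intro Y hY
  obtain ⟨Z, ρ, hρ, hres⟩ := hdown
  -- the two blow-ups: the nose upstairs, `Bl_Λ ℙⁿ_k` downstairs
  obtain ⟨P₁, τ, hτ⟩ := exists_isBlowup (Proj (homogeneousSubmodule (Fin (n + 1)) O)) C
  obtain ⟨F₂, υ, hυ⟩ := exists_isBlowup (Proj (homogeneousSubmodule (Fin (n + 1)) k)) Λ
  obtain ⟨hYcl, hYirr, hYs, hH₁, hirr₁, hgood₁, hF₂, hirrD, ⟨e₂⟩, -⟩ :=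
    nosePackage₀ O k π hπ n H ι φ hφ' hφ C hCsm hgen hsupp P₁ τ hτ F₂ υ hυ Y hY
  haveI := hF₂
  obtain ⟨hsm, hpr⟩ := stub_projectiveAmbientSmoothProper O n
  have hint := isIntegral_specialFibre_projectiveSpace O n
  -- `ℙⁿ_k` and `H` are locally Noetherian
  haveI : IsLocallyNoetherian (Proj (homogeneousSubmodule (Fin (n + 1)) k)) := by
    haveI := (stub_projectiveAmbientSmoothProper k n).2
    exact LocallyOfFiniteType.isLocallyNoetherian
      (Proj.toSpecZero (homogeneousSubmodule (Fin (n + 1)) k) ≫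
        Spec.map (CommRingCat.ofHom (algebraMap k ((homogeneousSubmodule (Fin (n + 1)) k) 0))))
  haveI : IsLocallyNoetherian H := LocallyOfFiniteType.isLocallyNoetherian ι
  haveI : IsProper υ := hυ.isProper
  -- `H ≅ V(ι(H))_red`, compatibly with the embeddings
  have hιirr : IsIrreducible (Set.range ι) := by
    have h := (IrreducibleSpace.isIrreducible_univ H).image ι ι.continuous.continuousOn
    rwa [Set.image_univ] at h
  let TD : Closeds (Proj (homogeneousSubmodule (Fin (n + 1)) k)) := ⟨Set.range ι, ι.isClosedEmbedding.isClosed_range⟩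
  have hDker : vanishingIdeal TD = ι.ker := by
    rw [← Scheme.IdealSheafData.map_bot, ← Scheme.nilradical_eq_bot, ← Scheme.IdealSheafData.vanishingIdeal_top,
      Scheme.IdealSheafData.map_vanishingIdeal]
    congr 1
    ext1
    change Set.range ι = closure (ι '' Set.univ)
    rw [Set.image_univ, ι.isClosedEmbedding.isClosed_range.closure_eq]
  have hkerD : (vanishingIdeal TD).subschemeι.ker = ι.ker := by
    rw [Scheme.IdealSheafData.ker_subschemeι, hDker]
  let eD : H ⟶ (vanishingIdeal TD).subscheme := IsClosedImmersion.lift _ ι hkerD.le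
  have heD : eD ≫ (vanishingIdeal TD).subschemeι = ι := IsClosedImmersion.lift_fac _ ι hkerD.le
  haveI : IsIso eD := IsClosedImmersion.isIso_lift _ ι hkerD
  -- the embedded reduced strict transform is a blow-up of `V(ι(H))_red` along the trace of `Λ` (Stacks 080E), hence `≅ Z`
  obtain ⟨ρD, -, -, hρD⟩ := exists_isBlowup_reducedStrictTransform (Proj (homogeneousSubmodule (Fin (n + 1)) k)) F₂ υ Λ hυ
    (Set.range ι) ι.isClosedEmbedding.isClosed_range hιirr hgen
  have hb := hρD.comp_iso (asIso eD).symm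
  have hcomap : (Λ.comap (vanishingIdeal TD).subschemeι).comap (asIso eD).symm.inv = Λ.comap ι := by
    rw [← Scheme.IdealSheafData.comap_comp]
    change Λ.comap (eD ≫ (vanishingIdeal TD).subschemeι) = Λ.comap ι
    rw [heD]
  rw [hcomap] at hb
  obtain ⟨eZ, -, -⟩ := hρ.unique hb
  -- `Z` is integral and locally Noetherian; `V(closure univ)_red ≅ Z`
  have hΛι : Λ.comap ι ≠ ⊥ := by
    intro h
    apply hgen
    intro y hy
    obtain ⟨x, rfl⟩ := hy
    have hx : x ∈ ((Λ.comap ι).support : Set H) := by rw [h, Scheme.IdealSheafData.support_bot]; trivial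
    rw [support_comap] at hx
    exact hx
  haveI hZint : IsIntegral Z := hρ.isIntegral hΛι
  haveI : IsProper ρ := hρ.isProper
  haveI hZnoeth : IsLocallyNoetherian Z := LocallyOfFiniteType.isLocallyNoetherian ρ
  let TZ : Closeds Z := ⟨closure (Set.univ : Set Z), isClosed_closure⟩
  have hZker : vanishingIdeal TZ = (𝟙 Z : Z ⟶ Z).ker := by
    rw [← Scheme.IdealSheafData.map_bot, ← Scheme.nilradical_eq_bot, ← Scheme.IdealSheafData.vanishingIdeal_top,
      Scheme.IdealSheafData.map_vanishingIdeal]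
    congr 1
    ext1
    change closure (Set.univ : Set Z) = closure ((𝟙 Z : Z ⟶ Z) '' Set.univ)
    rw [Set.image_univ]
    congr 1
    ext z
    simp
  have hkerZ : (vanishingIdeal TZ).subschemeι.ker = (𝟙 Z : Z ⟶ Z).ker := by
    rw [Scheme.IdealSheafData.ker_subschemeι, hZker]
  let eU : Z ⟶ (vanishingIdeal TZ).subscheme := IsClosedImmersion.lift _ (𝟙 Z) hkerZ.le
  haveI : IsIso eU := IsClosedImmersion.isIso_lift _ (𝟙 Z) hkerZ
  -- match the embedded strict-transform set with the one of `nosePackage₀`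
  have hcl : (⟨closure (υ ⁻¹' (Set.range ι \ (Λ.support : Set (Proj (homogeneousSubmodule (Fin (n + 1)) k))))), isClosed_closure⟩ :
      Closeds F₂) = ⟨closure (closure (υ ⁻¹' (Set.range ι \ (Λ.support : Set (Proj (homogeneousSubmodule (Fin (n + 1)) k)))))),
      isClosed_closure⟩ := Closeds.ext (by
    change closure _ = closure (closure _)
    rw [closure_closure])
  rw [hcl] at eZ
  let e : (vanishingIdeal TZ).subscheme ≅ (vanishingIdeal (⟨closure (closure (τ ⁻¹' (Y \
      (C.support : Set (Proj (homogeneousSubmodule (Fin (n + 1)) O)))))), isClosed_closure⟩ : Closeds P₁)).subscheme :=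
    (asIso eU).symm ≪≫ eZ ≪≫ e₂
  have hTZirr : IsIrreducible (Set.univ : Set Z) := IrreducibleSpace.isIrreducible_univ Z
  let Yc : Closeds (Proj (homogeneousSubmodule (Fin (n + 1)) O)) := ⟨Y, hYcl⟩
  -- then points: T-ISO-0-REL from the nose stage with the INTRINSIC downstairs datum `(Z, univ)`
  obtain ⟨X₂, σ₂, S₂, hH₂, hirr₂, -, hreg₂⟩ := pointResolution_from_horizStage O (Proj (homogeneousSubmodule (Fin (n + 1)) O))
    q Yc hsm hpr hYs hYirr P₁ τ (closure (τ ⁻¹' (Y \ (C.support : Set (Proj (homogeneousSubmodule (Fin (n + 1)) O))))))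
    hH₁ hirr₁ (fun w _ => hgood₁ w) Z (Set.univ : Set Z) isClosed_univ hTZirr e hres
  obtain ⟨hchain, -⟩ := natChain_and_isIrreducible_of_horizChainE1 O (Proj (homogeneousSubmodule (Fin (n + 1)) O)) X₂ q Y σ₂ S₂
    hsm hpr hint hYirr hYcl hYs hH₂
  exact ⟨X₂, σ₂, S₂, hchain, hirr₂, hreg₂⟩

/-- **`ELNatOver` FROM (5) T-NOSE-THEN-POINTS, intrinsic downstairs form** (`Λ` given on `ℙⁿ_k` with `C · 𝒪_{ℙⁿ_k} = Λ`
along every graded `φ` over `π`, as in `elNatOver_of_oneStep₀`; hypothesis (b′) on a blow-up of `H` along `Λ · 𝒪_H`). [folklore] -/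
theorem elNatOver_of_noseThenPoints_intrinsic {p : ℕ} (k : Type) [Field k] [CharP k p] [IsAlgClosed k] (n : ℕ) (H : Scheme.{0})
    (ι : H ⟶ (Literature.AlgebraicGeometry.Motives.projectiveSpace n k).left) [IsClosedImmersion ι] [IsIntegral H]
    (O : Type) [CommRing O] [IsDomain O] [IsDiscreteValuationRing O] [CharZero O]
    [IsAdicComplete (IsLocalRing.maximalIdeal O) O] [IsAlgClosed (IsLocalRing.ResidueField O)]
    (π : O →+* k) (hπ : Function.Surjective π)
    (C : (Proj (homogeneousSubmodule (Fin (n + 1)) O)).IdealSheafData)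
    (hCsm : Smooth (C.subschemeι ≫ Proj.toSpecZero (homogeneousSubmodule (Fin (n + 1)) O) ≫
      Spec.map (CommRingCat.ofHom (algebraMap O (homogeneousSubmodule (Fin (n + 1)) O 0)))))
    (Λ : (Proj (homogeneousSubmodule (Fin (n + 1)) k)).IdealSheafData)
    (hKEY : ∀ (φ : homogeneousSubmodule (Fin (n + 1)) O →+*ᵍ homogeneousSubmodule (Fin (n + 1)) k)
      (hφ' : HomogeneousIdeal.irrelevant (homogeneousSubmodule (Fin (n + 1)) k) ≤
        (HomogeneousIdeal.irrelevant (homogeneousSubmodule (Fin (n + 1)) O)).map φ),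
      (∀ s, φ s = MvPolynomial.map π s) → C.comap (Proj.map φ hφ') = Λ)
    (hgen : ¬ (Set.range ι ⊆ (Λ.support : Set (Proj (homogeneousSubmodule (Fin (n + 1)) k)))))
    (hsupp : (Λ.support : Set (Proj (homogeneousSubmodule (Fin (n + 1)) k))) ⊆ Set.range ι)
    (hdown : ∃ (Z : Scheme.{0}) (ρ : Z ⟶ H), IsBlowup ρ (Λ.comap ι) ∧
      ∃ (F' : Scheme.{0}) (ρ' : F' ⟶ Z) (T' : Set F'),
        (∀ Q : (∀ F₁ : Scheme.{0}, (F₁ ⟶ Z) → Set F₁ → Prop), Q Z (𝟙 Z) Set.univ →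
          (∀ (F₁ F₃ : Scheme.{0}) (ρ₁ : F₁ ⟶ Z) (T₁ : Set F₁)
            (x : ↥(vanishingIdeal (⟨closure T₁, isClosed_closure⟩ : Closeds F₁)).subscheme) (υ₁ : F₃ ⟶ F₁)
            (hx : IsClosed ({((vanishingIdeal (⟨closure T₁, isClosed_closure⟩ : Closeds F₁)).subschemeι x : F₁)} : Set F₁)),
            Q F₁ ρ₁ T₁ →
            ¬ IsRegularLocalRing ((vanishingIdeal (⟨closure T₁, isClosed_closure⟩ : Closeds F₁)).subscheme.presheaf.stalk x) →
            IsBlowup υ₁ (vanishingIdeal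
              (⟨{((vanishingIdeal (⟨closure T₁, isClosed_closure⟩ : Closeds F₁)).subschemeι x : F₁)}, hx⟩ : Closeds F₁)) →
            Q F₃ (υ₁ ≫ ρ₁) (closure (υ₁ ⁻¹' (T₁ \
              {((vanishingIdeal (⟨closure T₁, isClosed_closure⟩ : Closeds F₁)).subschemeι x : F₁)})))) →
          Q F' ρ' T') ∧
        Scheme.IsRegular (vanishingIdeal (⟨closure T', isClosed_closure⟩ : Closeds F')).subscheme) :
    Theorems.EquisingularLift.ELNatOver p k n H ι O π := by
  intro φ hφ' hφ Y hY
  let ι' : H ⟶ Proj (homogeneousSubmodule (Fin (n + 1)) k) := ι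
  haveI : IsClosedImmersion ι' := ‹IsClosedImmersion ι›
  have hK := hKEY φ hφ' hφ
  exact elNatBody_of_noseThenPoints_intrinsic O k π hπ n H ι' φ hφ' hφ C hCsm (by rw [hK]; exact hgen)
    (by rw [hK]; exact hsupp) (by rw [hK]; exact hdown) Y hY

/-- **`ELNatAt` FROM (5) T-NOSE-THEN-POINTS, intrinsic downstairs form** — packaged with `elNatAt_of_elNatOver`. [folklore] -/
theorem elNatAt_of_noseThenPoints_intrinsic {p : ℕ} (k : Type) [Field k] [CharP k p] [IsAlgClosed k] (n : ℕ) (H : Scheme.{0})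
    (ι : H ⟶ (Literature.AlgebraicGeometry.Motives.projectiveSpace n k).left) [IsClosedImmersion ι] [IsIntegral H]
    (O : Type) [CommRing O] [IsDomain O] [IsDiscreteValuationRing O] [CharZero O]
    [IsAdicComplete (IsLocalRing.maximalIdeal O) O] [IsAlgClosed (IsLocalRing.ResidueField O)]
    (π : O →+* k) (hπ : Function.Surjective π)
    (C : (Proj (homogeneousSubmodule (Fin (n + 1)) O)).IdealSheafData)
    (hCsm : Smooth (C.subschemeι ≫ Proj.toSpecZero (homogeneousSubmodule (Fin (n + 1)) O) ≫
      Spec.map (CommRingCat.ofHom (algebraMap O (homogeneousSubmodule (Fin (n + 1)) O 0)))))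
    (Λ : (Proj (homogeneousSubmodule (Fin (n + 1)) k)).IdealSheafData)
    (hKEY : ∀ (φ : homogeneousSubmodule (Fin (n + 1)) O →+*ᵍ homogeneousSubmodule (Fin (n + 1)) k)
      (hφ' : HomogeneousIdeal.irrelevant (homogeneousSubmodule (Fin (n + 1)) k) ≤
        (HomogeneousIdeal.irrelevant (homogeneousSubmodule (Fin (n + 1)) O)).map φ),
      (∀ s, φ s = MvPolynomial.map π s) → C.comap (Proj.map φ hφ') = Λ)
    (hgen : ¬ (Set.range ι ⊆ (Λ.support : Set (Proj (homogeneousSubmodule (Fin (n + 1)) k)))))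
    (hsupp : (Λ.support : Set (Proj (homogeneousSubmodule (Fin (n + 1)) k))) ⊆ Set.range ι)
    (hdown : ∃ (Z : Scheme.{0}) (ρ : Z ⟶ H), IsBlowup ρ (Λ.comap ι) ∧
      ∃ (F' : Scheme.{0}) (ρ' : F' ⟶ Z) (T' : Set F'),
        (∀ Q : (∀ F₁ : Scheme.{0}, (F₁ ⟶ Z) → Set F₁ → Prop), Q Z (𝟙 Z) Set.univ →
          (∀ (F₁ F₃ : Scheme.{0}) (ρ₁ : F₁ ⟶ Z) (T₁ : Set F₁)
            (x : ↥(vanishingIdeal (⟨closure T₁, isClosed_closure⟩ : Closeds F₁)).subscheme) (υ₁ : F₃ ⟶ F₁)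
            (hx : IsClosed ({((vanishingIdeal (⟨closure T₁, isClosed_closure⟩ : Closeds F₁)).subschemeι x : F₁)} : Set F₁)),
            Q F₁ ρ₁ T₁ →
            ¬ IsRegularLocalRing ((vanishingIdeal (⟨closure T₁, isClosed_closure⟩ : Closeds F₁)).subscheme.presheaf.stalk x) →
            IsBlowup υ₁ (vanishingIdeal
              (⟨{((vanishingIdeal (⟨closure T₁, isClosed_closure⟩ : Closeds F₁)).subschemeι x : F₁)}, hx⟩ : Closeds F₁)) →
            Q F₃ (υ₁ ≫ ρ₁) (closure (υ₁ ⁻¹' (T₁ \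
              {((vanishingIdeal (⟨closure T₁, isClosed_closure⟩ : Closeds F₁)).subschemeι x : F₁)})))) →
          Q F' ρ' T') ∧
        Scheme.IsRegular (vanishingIdeal (⟨closure T', isClosed_closure⟩ : Closeds F')).subscheme) :
    Theorems.EquisingularLift.ELNatAt p k n H ι :=
  Theorems.EquisingularLift.elNatAt_of_elNatOver hπ
    (elNatOver_of_noseThenPoints_intrinsic k n H ι O π hπ C hCsm Λ hKEY hgen hsupp hdown)

end Summit.ResolutionOfSingularities.ResolutionOfSingularities.Cruxes.EquisingularLiftNat.Sections

end
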